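import Mathlib

/-!
# `MatrixDescartes` census, `m = 2` row — DEFINITIONS of the all-`K` «Viro + square splitting» family (`ζ_sym(2,K) ≥ 4K − 7`)

HONEST FRAMING.  Definitions only (val-V1-extremal engine seat val-v1x-eng-6 g2, `--supports stmt-ValiantsHypothesis-18050`);
the theorems are in `…VSQKit` (dominance analysis), `…VSQDesign` (exponent bookkeeping), `…VSQPoints` (signs at the test
points), `…VSQLaw` (`vsq_law : ∀ K ≥ 4, ¬ PosRootLawAt 2 K (4K − 8)`).  Nothing here bears on the crux `MatrixDescartes`
(stmt-18050, asymptotic, `m ≤ 2^{polylog K}`) or on `VP ≠ VNP`.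

OBJECTS.
* `tv B h d t = B^h · t^d`, `bnom B s h d t = ∑_l s_l B^{h_l} t^{d_l}` — a signed `B`-adic `K`-nomial; `Dom` (one term beats every
  other present term by a factor `B`), `Below` (every present term `≤ M`); `sym2` — the symmetric `2 × 2` letters
  `[[a_l, b_l], [b_l, c_l]]` built from three signed `B`-adic `K`-nomials.
* THE FAMILY (parameter `n = K − 2 ≥ 2`, letters `v = 0, …, n + 1`, base `B = 4K²`): support `dN`: `d_0 = 0`, `d_v = n + v`
  (`1 ≤ v ≤ n`), `d_{n+1} = n² + 5n`; integer heights `haN`, `hbN`, `hcN` (offset `qa = 3n² + 5n + 4`) and signs `saR`, `sbR`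
  (`b_0 = b_{n+1} = 0`), `scR`; `ea/eb/ec n v x = h_v + x·d_v` = `log_B` of the `v`-th term of `a/b/c` at `t = B^x`;
  `Fin`-indexed copies `dF, saF, …, hcF`; the pencil `letters n B`, its entries `fa, fb, fc` and `D = fa·fc − fb²`.
* THE TEST POINTS `tau n B j`, `j = 0, …, 4n + 1`: `B^{2j−1}` for `j ≤ n + 1` (the `a`-chain alternates, then the first
  `b²`-point `x = 2n + 1`); for `n + 2 ≤ j ≤ 3n − 1` alternately the bracketed zero `bz n B w` of `b` in
  `(B^{2n+2w−1}, B^{2n+2w+1})` (a `Classical.epsilon` choice; there `det = ac > 0` — SQUARE SPLITTING) and the `b²`-point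
  `B^{j+n}`; then `B^{2j−2n+3}` for `j ≥ 3n` (the `c`-chain alternates).  Design schedule (`x = log_B t`): `a` switches
  `0→1→⋯→n` at `x = 0, 2, …, 2n−2` and `n→n+1` at `4n`; `b` switches `1→⋯→n` at `2n+2, …, 4n−2`; `c` switches `0→⋯→n+1` at
  `4n+4, …, 6n+4`; `ac ≷ b²` crosses at `x = 2n` and `x = 4n + 2`.
[folklore] Viro patchworking data; elementary.
-/

set_option linter.dupNamespace false
set_option autoImplicit false

namespace Summit.ValiantsHypothesis.ValiantsHypothesis.Theorems.LacunarySymmetroidMatrixDescartes.VSQ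

open scoped BigOperators

/-! ## 1. Signed `B`-adic `K`-nomials and the symmetric `2 × 2` letters -/

variable {K : ℕ}

/-- size `B^h · t^d` of one unsigned `B`-adic monomial. [folklore] -/
noncomputable def tv (B : ℝ) (h : ℤ) (d : ℕ) (t : ℝ) : ℝ := B ^ h * t ^ d

/-- the signed `B`-adic `K`-nomial `∑_l s_l · B^{h_l} · t^{d_l}`. [folklore] -/
noncomputable def bnom (B : ℝ) (s : Fin K → ℝ) (h : Fin K → ℤ) (d : Fin K → ℕ) (t : ℝ) : ℝ :=
  ∑ l, s l * tv B (h l) (d l) t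

/-- term `l₀` DOMINATES at `t` with one unit of `B` to spare: every other present term is `≤ tv l₀ / B`. [folklore] -/
def Dom (B : ℝ) (s : Fin K → ℝ) (h : Fin K → ℤ) (d : Fin K → ℕ) (t : ℝ) (l₀ : Fin K) : Prop :=
  ∀ l, l ≠ l₀ → s l = 0 ∨ B * tv B (h l) (d l) t ≤ tv B (h l₀) (d l₀) t

/-- every present term is `≤ M` at `t`. [folklore] -/
def Below (B : ℝ) (s : Fin K → ℝ) (h : Fin K → ℤ) (d : Fin K → ℕ) (t : ℝ) (M : ℝ) : Prop :=
  ∀ l, s l = 0 ∨ tv B (h l) (d l) t ≤ M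

/-- the symmetric letters `[[a_l, b_l], [b_l, c_l]]` with `a_l = s^a_l B^{h^a_l}` etc. [folklore] -/
noncomputable def sym2 (B : ℝ) (sa sb sc : Fin K → ℝ) (ha hb hc : Fin K → ℤ) (l : Fin K) :
    Matrix (Fin 2) (Fin 2) ℝ :=
  !![sa l * B ^ ha l, sb l * B ^ hb l; sb l * B ^ hb l, sc l * B ^ hc l]

/-! ## 2. The family (`K = n + 2`) -/

/-- exponents: `d_0 = 0`, `d_v = n + v` (`1 ≤ v ≤ n`), `d_{n+1} = n² + 5n`. [folklore] -/
def dN (n v : ℕ) : ℕ := if v = 0 then 0 else if v ≤ n then n + v else n ^ 2 + 5 * n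

/-- the height offset `qa = 3n² + 5n + 4` of the `a`- and `b`-chains. [folklore] -/
def qa (n : ℕ) : ℤ := 3 * (n : ℤ) ^ 2 + 5 * n + 4

/-- heights of `a`: `qa`, `qa − (v−1)v`, `qa − 4n³ − 13n² + n`. [folklore] -/
def haN (n v : ℕ) : ℤ :=
  if v = 0 then qa n else if v ≤ n then qa n - ((v : ℤ) - 1) * v
  else qa n - 4 * (n : ℤ) ^ 3 - 13 * (n : ℤ) ^ 2 + n

/-- heights of `b` (block formula; off the block the sign is `0`): `qa − (v−1)² − (2n+1)(v−1)`. [folklore] -/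
def hbN (n v : ℕ) : ℤ := qa n - ((v : ℤ) - 1) ^ 2 - (2 * (n : ℤ) + 1) * ((v : ℤ) - 1)

/-- heights of `c`: `4(n+1)²`, `−(v−1)² − (4n+5)(v−1)`, `−6n³ − 27n² − 11n + 4`. [folklore] -/
def hcN (n v : ℕ) : ℤ :=
  if v = 0 then 4 * ((n : ℤ) + 1) ^ 2 else if v ≤ n then -((v : ℤ) - 1) ^ 2 - (4 * (n : ℤ) + 5) * ((v : ℤ) - 1)
  else -6 * (n : ℤ) ^ 3 - 27 * (n : ℤ) ^ 2 - 11 * n + 4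

/-- signs of `a`: `(−1)^n`, `(−1)^{n+v}`, `+1`. [folklore] -/
def saR (n v : ℕ) : ℝ := if v = 0 then (-1) ^ n else if v ≤ n then (-1) ^ (n + v) else 1

/-- signs of `b`: `0`, `(−1)^{v+1}`, `0`. [folklore] -/
def sbR (n v : ℕ) : ℝ := if v = 0 then 0 else if v ≤ n then (-1) ^ (v + 1) else 0

/-- signs of `c`: `+1`, `(−1)^v`, `(−1)^{n+1}`. [folklore] -/
def scR (n v : ℕ) : ℝ := if v = 0 then 1 else if v ≤ n then (-1) ^ v else (-1) ^ (n + 1)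

/-- `log_B` size of the `a`-term `v` at `x`. [folklore] -/
def ea (n v : ℕ) (x : ℤ) : ℤ := haN n v + x * (dN n v : ℤ)

/-- `log_B` size of the `b`-term `v` at `x`. [folklore] -/
def eb (n v : ℕ) (x : ℤ) : ℤ := hbN n v + x * (dN n v : ℤ)

/-- `log_B` size of the `c`-term `v` at `x`. [folklore] -/
def ec (n v : ℕ) (x : ℤ) : ℤ := hcN n v + x * (dN n v : ℤ)

/-- exponents, `Fin`-indexed. [folklore] -/
def dF (n : ℕ) : Fin (n + 2) → ℕ := fun l => dN n l
/-- signs of `a`, `Fin`-indexed. [folklore] -/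
def saF (n : ℕ) : Fin (n + 2) → ℝ := fun l => saR n l
/-- signs of `b`, `Fin`-indexed. [folklore] -/
def sbF (n : ℕ) : Fin (n + 2) → ℝ := fun l => sbR n l
/-- signs of `c`, `Fin`-indexed. [folklore] -/
def scF (n : ℕ) : Fin (n + 2) → ℝ := fun l => scR n l
/-- heights of `a`, `Fin`-indexed. [folklore] -/
def haF (n : ℕ) : Fin (n + 2) → ℤ := fun l => haN n l
/-- heights of `b`, `Fin`-indexed. [folklore] -/
def hbF (n : ℕ) : Fin (n + 2) → ℤ := fun l => hbN n l
/-- heights of `c`, `Fin`-indexed. [folklore] -/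
def hcF (n : ℕ) : Fin (n + 2) → ℤ := fun l => hcN n l

/-- the letters `S_l = [[a_l, b_l], [b_l, c_l]]` of the family (`K = n + 2`, base `B`). [folklore] -/
noncomputable def letters (n : ℕ) (B : ℝ) : Fin (n + 2) → Matrix (Fin 2) (Fin 2) ℝ :=
  sym2 B (saF n) (sbF n) (scF n) (haF n) (hbF n) (hcF n)

/-- the entry `a(t)`. [folklore] -/
noncomputable def fa (n : ℕ) (B t : ℝ) : ℝ := bnom B (saF n) (haF n) (dF n) t
/-- the entry `b(t)`. [folklore] -/
noncomputable def fb (n : ℕ) (B t : ℝ) : ℝ := bnom B (sbF n) (hbF n) (dF n) t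
/-- the entry `c(t)`. [folklore] -/
noncomputable def fc (n : ℕ) (B t : ℝ) : ℝ := bnom B (scF n) (hcF n) (dF n) t
/-- `det = ac − b²` as a function of `t`. [folklore] -/
noncomputable def D (n : ℕ) (B t : ℝ) : ℝ := fa n B t * fc n B t - fb n B t ^ 2

/-! ## 3. The test points -/

/-- the bracketed zero of `b` in `(B^{2n+2w−1}, B^{2n+2w+1})` (a choice; it exists for `1 ≤ w ≤ n − 1`,
`…VSQPoints.bz_spec`). [folklore] -/
noncomputable def bz (n : ℕ) (B : ℝ) (w : ℕ) : ℝ :=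
  Classical.epsilon fun t => B ^ (2 * (n : ℤ) + 2 * w - 1) < t ∧ t < B ^ (2 * (n : ℤ) + 2 * (w + 1 : ℕ) - 1) ∧ fb n B t = 0

/-- the `4n + 2` test points `j = 0, …, 4n + 1` (see the module docstring). [folklore] -/
noncomputable def tau (n : ℕ) (B : ℝ) (j : ℕ) : ℝ :=
  if j ≤ n + 1 then B ^ (2 * (j : ℤ) - 1)
  else if j ≤ 3 * n - 1 then (if (j - n) % 2 = 0 then bz n B ((j - n) / 2) else B ^ ((j : ℤ) + n))
  else B ^ (2 * (j : ℤ) - 2 * n + 3)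

end Summit.ValiantsHypothesis.ValiantsHypothesis.Theorems.LacunarySymmetroidMatrixDescartes.VSQ
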